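import Summits.HodgeConjecture.HodgeConjecture.Theorems.Ring2HypothesesDescentFibreClassPaddingLarge
import Summits.HodgeConjecture.HodgeConjecture.Theorems.Ring2AbelianAllAndreLerayBottomPiece
import Literature.AlgebraicGeometry.HodgeTheory.AlgebraicClassesGysinOneSpan
import HarnessLib

/-!
# Ring 2 hypotheses, descent face — THE β-PACKAGE AS ONE CYCLE CLASS: on the padded pencil `A₀ × 𝒴` (A₀ a copy of the fibre
# `𝒴_{t₀}`) the class `[Γ]` of the graph of `A₀ ≅ 𝒴_{t₀} ↪ 𝒴` — an ALGEBRAIC `d`-cycle on the `(2d+1)`-fold `A₀ × 𝒴` — is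
# «cup with the fibre class» of an ALGEBRAIC class `D ∈ N^d H^{2d}(A₀ × 𝒴)` as soon as the β-package of `𝒴` holds: the
# find-the-cycle form of the β-column, necessary direction

research route conditional on HC_CM; not a corollary; Q11.4-sentence-2 already refuted in dim ≥ 3.
Cell `pub-hodge-ring2` (Hodge ladder STAGE 3), seat `ring2-b05` (binder row b05 `Ring2.Hypotheses.MotivatedImpliesAlgebraicAV`,
published modulo X = `Ring2.AbelianAll.LefschetzBCompactPencils`), gen 50, fifth file. `HC_CM` does not occur in this file; the
β-packages are displayed HYPOTHESES; nothing here proves a case of the Hodge conjecture or of `B`; no binder is discharged; no node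
of the cell is asserted.

THE POINT. By the fourth file, the β-package of a compact pencil `f : 𝒴 ⟶ S` of abelian `d`-folds is the middle clause of the padded
pencil `A₀ × 𝒴 ⟶ S` for ANY abelian `d`-fold `A₀` — e.g. a copy of a fibre, `φ : A₀ ⥲ 𝒴_{t₀}` (`exists_abelianVariety_fiber`). That
pencil carries a distinguished ALGEBRAIC class: the graph `Γ = {(a, φ a)} ⊂ A₀ × 𝒴_{t₀} ⊂ A₀ × 𝒴` of the fibre inclusion, a `d`-cycle
on the `(2d+1)`-fold `A₀ × 𝒴`, `[Γ] = γ_* 1 ∈ H^{2d+2}((A₀ × 𝒴)(ℂ))`, `γ = (𝟙, φ ≫ j_{t₀})`. Since `Γ` lies in the fibre `F_{t₀}`,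
`[Γ] = J_{t₀*}[Γ ⊂ F_{t₀}]` lies in the range of `L_{t₀} = J_{t₀*} J_{t₀}^*` (part XXVI-a: `range J_{t₀*} = J_{t₀*}(Im J_{t₀}^*)`), say
`[Γ] = L_{t₀} Γ̃` — `Γ̃` a TOPOLOGICAL class whose fibre restrictions are the invariant projections of the graph. **If the β-package of
`𝒴` holds**, the middle two-point inverse `T` of `A₀ × 𝒴` (fourth file) gives the ALGEBRAIC class `D := T[Γ] ∈ N^d H^{2d}(A₀ × 𝒴)`
(algebraic correspondences preserve algebraic classes, `map_mem_algebraicClasses_of_isAlgebraicCorrespondence`) with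
**`L_{t₀} D = [Γ]`**: the graph class is DIVISIBLE BY THE FIBRE CLASS among algebraic classes (`exists_algebraic_fibreClassDivisor_graph`).
So every refutation of that divisibility on ONE pencil refutes its β-package (and X); and `D` is the «spreading machine» of the
cell's transport rows: `D_*` carries a class of `A₀ ≅ 𝒴_{t₀}` to a global class of `𝒴` with the invariant projections as fibre
restrictions. The CONVERSE («such a `D` gives back the whole β-package», `T_k = c · D_* ∘ D^*`) is NOT in this file.

* §1 `graphClass_mem_algebraicClasses`, `graphClass_mem_range_fiberGysin` — `[Γ]` is algebraic and lies in `range L_{t₀}`.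
* §2 **`exists_algebraic_fibreClassDivisor_graph`** — β-package of `𝒴` ⟹ `∃ D ∈ N^d`, `L_{t₀} D = [Γ]`; the same from `(mid)(B × 𝒴)`
  for any large `B`, and from `B⋆(𝒴)`.

HONEST COLUMN. No definition, no named fact, no sorry. What moved: a find-the-cycle NECESSARY condition for the β-package of any
compact abelian pencil, on one auxiliary `(2d+1)`-fold, for one explicit algebraic class. NOT claimed: the converse; any instance.
References: Abdulali1994FamiliesAV (Conj. 5.3 p. 1130); VoisinHodgeII2003 (Prop. 9.21, (10.7)); Fulton1998 (§16.1, §19.2);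
FultonYoungTableaux1997 (App. B §B.1); DeligneHodgeII1971 (4.1.1); Kleiman1968AlgebraicCycles (§2).
-/

noncomputable section

-- every declaration of this problem lives in `Summit.HodgeConjecture.HodgeConjecture.…` (summit = sub-problem)
set_option linter.dupNamespace false

open CategoryTheory CategoryTheory.Limits AlgebraicGeometry MonoidalCategory CartesianMonoidalCategory
open Literature.AlgebraicGeometry Literature.AlgebraicGeometry.Motives Literature.AlgebraicGeometry.HodgeTheory
open Literature.AlgebraicTopology.SingularHomology
open Summit.HodgeConjecture.HodgeConjecture.Ring2.AbelianAll

namespace Summit.HodgeConjecture.HodgeConjecture.Theorems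

/-- `βall⟦f, hf, d, k⟧` — INPUT NOTATION (not a definition): the two-point fibre-class inverse in degree `k` of ONE compact pencil
`f : 𝒴 ⟶ S` of abelian `d`-folds (gen 46's shape). [cite: Abdulali1994FamiliesAV, Conjecture 5.3 (p. 1130)] [cite: Tankeev2003, Thm. 10.1] -/
local notation3 (prettyPrint := false) "βall⟦" f ", " hf ", " d ", " k "⟧" =>
  ∃ T : complexBetti _ (k + 2) →ₗ[ℂ] complexBetti _ k,
    IsAlgebraicCorrespondence (d + 1) (d + 1) _ _ T ∧
      ∀ (y : complexBetti _ k) (t s : ComplexPoints _),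
        complexBetti.map (fiberι f s) k
            (T (complexGysin complexOrientationFamily (IsCompactAbelianPencil.isSmoothProjective_fiberOver hf t)
              (IsCompactAbelianPencil.isSmoothProjective_total hf) (fiberι f t) (deg_fiberGysin_aux k d)
              (complexBetti.map (fiberι f t) k y))) =
          complexBetti.map (fiberι f s) k y

/-- Degree bookkeeping for the graph class: `0 + 2(2d + 1) = 2(d + 1) + 2d`. [folklore] -/
theorem deg_graph_aux (d : ℕ) : 0 + 2 * (2 * d + 1) = 2 * (d + 1) + 2 * d := by omega

/-- `Γ⟦hA, hF, φ, t₀⟧` — INPUT NOTATION (not a definition): the class `γ_* 1 ∈ H^{2(d+1)}((A₀ × 𝒴)(ℂ); ℂ)` of the graph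
`γ = (𝟙, φ ≫ j_{t₀}) : A₀ ⟶ A₀ × 𝒴` of a morphism `φ : A₀ ⟶ 𝒴_{t₀}` into the fibre (complex orientations; `hA`, `hF` the smooth
projective data of `A₀` in dimension `d` and of the padded pencil). [cite: FultonYoungTableaux1997, Appendix B §B.1 (5)] -/
local notation3 (prettyPrint := false) "Γ⟦" hA ", " hF ", " φ ", " t₀ "⟧" =>
  complexGysin complexOrientationFamily hA (IsCompactAbelianPencil.isSmoothProjective_total hF) (lift (𝟙 _) (φ ≫ fiberι _ t₀))
    (deg_graph_aux _) (singularCohomology.one ℂ (ComplexPoints _))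

variable {d : ℕ} {𝒴 S : SchemeOver ℂ} {f : 𝒴 ⟶ S}

/-! ## §1 The graph class of a fibre in the padded pencil: algebraic, and in the range of `L_{t₀}` -/

section Graph

variable (A₀ : AbelianVariety ℂ) (hA₀ : A₀.dim = d) (t₀ : ComplexPoints S) (φ : A₀.X ⟶ fiberOver f t₀)
  (hF : IsCompactAbelianPencil (snd A₀.X 𝒴 ≫ f) (2 * d))
include hA₀

/-- `A₀` is smooth projective of dimension `d` (transport of `AbelianVariety.isSmoothProjective_holds` along `dim A₀ = d`). [folklore] -/
theorem isSmoothProjective_abelianVariety_of_dim_eq : IsSmoothProjective d A₀.X := hA₀ ▸ AbelianVariety.isSmoothProjective_holds (A := A₀)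

/-- **The graph class `[Γ] = γ_* 1` is ALGEBRAIC** (`N^{d+1} H^{2d+2}(A₀ × 𝒴)`: the class of the `d`-cycle `Γ ≅ A₀`; the tree's
`complexGysin_graph_one_mem_algebraicClasses`). [cite: VoisinHodgeII2003, §9.2.4 Prop. 9.20] [cite: Fulton1998, §16.1] -/
theorem graphClass_mem_algebraicClasses :
    Γ⟦isSmoothProjective_abelianVariety_of_dim_eq A₀ hA₀, hF, φ, t₀⟧ ∈ algebraicClasses (A₀.X ⊗ 𝒴) (d + 1) :=
  complexGysin_one_mem_algebraicClasses_codim complexOrientationFamily (p := d + 1) (by omega)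
    (isSmoothProjective_abelianVariety_of_dim_eq A₀ hA₀) hF.isSmoothProjective_total _ _

/-- **`[Γ]` lies in the range of `L_{t₀} = J_{t₀*} J_{t₀}^*`**: `γ` factors through the fibre `F_{t₀} ≅ A₀ × 𝒴_{t₀}` of the padded pencil
(`exists_fiberOver_snd_comp_iso`), so `[Γ] = J_{t₀*}[Γ ⊂ F_{t₀}]` (`complexGysin_comp`), and `range J_{t₀*} = range L_{t₀}` (part XXVI-a,
`range_fiberGysin_eq_range_comp`). [cite: DeligneHodgeII1971, Thm. 4.1.1] [cite: FultonYoungTableaux1997, Appendix B §B.1 (5)–(6)] -/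
theorem graphClass_mem_range_fiberGysin :
    Γ⟦isSmoothProjective_abelianVariety_of_dim_eq A₀ hA₀, hF, φ, t₀⟧ ∈
      LinearMap.range (fiberGysin hF t₀ d ∘ₗ (complexBetti.map (fiberι (snd A₀.X 𝒴 ≫ f) t₀) (2 * d)).hom) := by
  have hμ : complexOrientationFamily.HasPoincareDuality := OrientationFamily.hasPoincareDuality _
  have hA := isSmoothProjective_abelianVariety_of_dim_eq A₀ hA₀
  obtain ⟨e, he⟩ := exists_fiberOver_snd_comp_iso f A₀.X t₀
  -- `γ = (𝟙, φ) ≫ e ≫ J_{t₀}`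
  have hγ : lift (𝟙 A₀.X) (φ ≫ fiberι f t₀) = (lift (𝟙 A₀.X) φ ≫ e.hom) ≫ fiberι (snd A₀.X 𝒴 ≫ f) t₀ := by
    rw [Category.assoc, he, lift_whiskerLeft]
  rw [← range_fiberGysin_eq_range_comp hF t₀]
  refine ⟨complexGysin complexOrientationFamily hA (hF.isSmoothProjective_fiberOver t₀) (lift (𝟙 A₀.X) φ ≫ e.hom)
    (show 0 + 2 * (2 * d) = 2 * d + 2 * d by omega) (singularCohomology.one ℂ (ComplexPoints A₀.X)), ?_⟩
  change complexGysin complexOrientationFamily (hF.isSmoothProjective_fiberOver t₀) hF.isSmoothProjective_total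
      (fiberι (snd A₀.X 𝒴 ≫ f) t₀) _ (complexGysin complexOrientationFamily hA (hF.isSmoothProjective_fiberOver t₀)
        (lift (𝟙 A₀.X) φ ≫ e.hom) _ _) = _
  rw [← LinearMap.comp_apply, ← complexGysin_comp hμ hA (hF.isSmoothProjective_fiberOver t₀) hF.isSmoothProjective_total
    (lift (𝟙 A₀.X) φ ≫ e.hom) (fiberι (snd A₀.X 𝒴 ≫ f) t₀)]
  simp only [← hγ]

end Graph

/-! ## §2 The β-package of `𝒴` makes the graph class divisible by the fibre class among ALGEBRAIC classes -/

section Divisor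

variable (A₀ : AbelianVariety ℂ) (hA₀ : A₀.dim = d) (t₀ : ComplexPoints S) (φ : A₀.X ⟶ fiberOver f t₀)
  (hF : IsCompactAbelianPencil (snd A₀.X 𝒴 ≫ f) (2 * d))
include hA₀

/-- **From the middle clause of the padded pencil: `(mid)(A₀ × 𝒴) ⟹ ∃ D ∈ N^d H^{2d}(A₀ × 𝒴)` with `L_{t₀} D = [Γ]`** — `D := T[Γ]`
for the middle two-point inverse `T`: `[Γ] = L_{t₀} Γ̃` (§1), `J_{t₀}^* T L_{t₀} Γ̃ = J_{t₀}^* Γ̃`, apply `J_{t₀*}`; `D` is algebraic because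
`T` and `[Γ]` are. Hypothesis displayed, not asserted. [cite: VoisinHodgeII2003, Prop. 9.21 and (10.7)] [cite: Abdulali1994FamiliesAV, Conjecture 5.3 (p. 1130)] -/
theorem exists_algebraic_fibreClassDivisor_graph_of_middle
    (h : ∃ T : complexBetti (A₀.X ⊗ 𝒴) (2 * (d + 1)) →ₗ[ℂ] complexBetti (A₀.X ⊗ 𝒴) (2 * d),
      IsAlgebraicCorrespondence (2 * d + 1) (2 * d + 1) (A₀.X ⊗ 𝒴) (A₀.X ⊗ 𝒴) T ∧
        ∀ (W : complexBetti (A₀.X ⊗ 𝒴) (2 * d)) (t s : ComplexPoints S),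
          complexBetti.map (fiberι (snd A₀.X 𝒴 ≫ f) s) (2 * d)
              (T (fiberGysin hF t d (complexBetti.map (fiberι (snd A₀.X 𝒴 ≫ f) t) (2 * d) W))) =
            complexBetti.map (fiberι (snd A₀.X 𝒴 ≫ f) s) (2 * d) W) :
    ∃ D ∈ algebraicClasses (A₀.X ⊗ 𝒴) d,
      fiberGysin hF t₀ d (complexBetti.map (fiberι (snd A₀.X 𝒴 ≫ f) t₀) (2 * d) D) =
        Γ⟦isSmoothProjective_abelianVariety_of_dim_eq A₀ hA₀, hF, φ, t₀⟧ := by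
  obtain ⟨T, algT, hT⟩ := h
  obtain ⟨Γ', hΓ'⟩ := graphClass_mem_range_fiberGysin A₀ hA₀ t₀ φ hF
  have hP := hF.isSmoothProjective_total
  refine ⟨T (Γ⟦isSmoothProjective_abelianVariety_of_dim_eq A₀ hA₀, hF, φ, t₀⟧),
    map_mem_algebraicClasses_of_isAlgebraicCorrespondence hP hP algT
      (graphClass_mem_algebraicClasses A₀ hA₀ t₀ φ hF), ?_⟩
  rw [← hΓ', LinearMap.comp_apply, hT Γ' t₀ t₀]

/-- **THE β-PACKAGE OF `𝒴` MAKES THE GRAPH CLASS DIVISIBLE BY THE FIBRE CLASS AMONG ALGEBRAIC CLASSES**: if `𝒴` has algebraic two-point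
fibre-class inverses in every degree `k ≤ 2d + 1`, then for every abelian `d`-fold `A₀`, every point `t₀` and every morphism
`φ : A₀ ⟶ 𝒴_{t₀}` there is `D ∈ N^d H^{2d}((A₀ × 𝒴)(ℂ); ℂ)` with `J_{t₀*} J_{t₀}^* D = [Γ_φ]` (the fourth file's upward arrow gives the middle
clause of `A₀ × 𝒴`, then the previous theorem). Hypothesis displayed, not asserted. [cite: Abdulali1994FamiliesAV, Conjecture 5.3 (p. 1130)]
[cite: VoisinHodgeII2003, Prop. 9.21 and (10.7)] [cite: Kleiman1968AlgebraicCycles, §2 and Appendix 2A] -/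
theorem exists_algebraic_fibreClassDivisor_graph (hf : IsCompactAbelianPencil f d)
    (hβ : ∀ k : ℕ, k ≤ 2 * d + 1 → βall⟦f, hf, d, k⟧) :
    ∃ D ∈ algebraicClasses (A₀.X ⊗ 𝒴) d,
      fiberGysin hF t₀ d (complexBetti.map (fiberι (snd A₀.X 𝒴 ≫ f) t₀) (2 * d) D) =
        Γ⟦isSmoothProjective_abelianVariety_of_dim_eq A₀ hA₀, hF, φ, t₀⟧ :=
  exists_algebraic_fibreClassDivisor_graph_of_middle A₀ hA₀ t₀ φ hF
    (fibreClassLefschetzOn_snd_comp_of_fibreClassInverses hf A₀ hF (by omega) hβ d (by omega))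

/-- **The same from ONE large padding: `(mid)(B × 𝒴)` for an abelian `B` with `dim B ≥ d`, `dim B + d` even ⟹ the divisor `D` of the
graph class on `A₀ × 𝒴`** (fourth file's `exists_fibreClassInverse_of_middle_prod`, then the previous theorem).
[cite: Abdulali1994FamiliesAV, Conjecture 5.3 (p. 1130)] [cite: Kleiman1968AlgebraicCycles, §1.3 and §2] -/
theorem exists_algebraic_fibreClassDivisor_graph_of_middle_prod (hf : IsCompactAbelianPencil f d) (B : AbelianVariety ℂ)
    (hg : d ≤ B.dim) {m : ℕ}
    (hm : B.dim + d = 2 * m) (hB : IsCompactAbelianPencil (snd B.X 𝒴 ≫ f) (2 * m))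
    (h : ∃ T : complexBetti (B.X ⊗ 𝒴) (2 * (m + 1)) →ₗ[ℂ] complexBetti (B.X ⊗ 𝒴) (2 * m),
      IsAlgebraicCorrespondence (2 * m + 1) (2 * m + 1) (B.X ⊗ 𝒴) (B.X ⊗ 𝒴) T ∧
        ∀ (W : complexBetti (B.X ⊗ 𝒴) (2 * m)) (t s : ComplexPoints S),
          complexBetti.map (fiberι (snd B.X 𝒴 ≫ f) s) (2 * m)
              (T (fiberGysin hB t m (complexBetti.map (fiberι (snd B.X 𝒴 ≫ f) t) (2 * m) W))) =
            complexBetti.map (fiberι (snd B.X 𝒴 ≫ f) s) (2 * m) W) :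
    ∃ D ∈ algebraicClasses (A₀.X ⊗ 𝒴) d,
      fiberGysin hF t₀ d (complexBetti.map (fiberι (snd A₀.X 𝒴 ≫ f) t₀) (2 * d) D) =
        Γ⟦isSmoothProjective_abelianVariety_of_dim_eq A₀ hA₀, hF, φ, t₀⟧ :=
  exists_algebraic_fibreClassDivisor_graph A₀ hA₀ t₀ φ hF hf fun _ hk ↦
    exists_fibreClassInverse_of_middle_prod hf B hg hm hB h hk

end Divisor

/-- **`B⋆(𝒴) ∀η ⟹` the divisor `D` of the graph class** (the β-package of `𝒴` follows from `B⋆(𝒴)`: gen 49's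
`forall_middle_snd_comp_of_lefschetzB` route, here through the first gen-50 file's `middle_powSucc_of_lefschetzB` and
`exists_fibreClassInverse_of_middle_powSucc` with any abelian curve). `B⋆(𝒴)` displayed, not asserted.
[cite: Kleiman1968AlgebraicCycles, §2 Cor. 2.5] [cite: Lieberman1968, main theorem] [cite: Abdulali1994FamiliesAV, Theorem 5.5 (p. 1130)] -/
theorem exists_algebraic_fibreClassDivisor_graph_of_lefschetzB {r : ℕ} {f : 𝒴 ⟶ S} (hf : IsCompactAbelianPencil f (r + 1))
    (A₀ : AbelianVariety ℂ) (hA₀ : A₀.dim = r + 1) (t₀ : ComplexPoints S) (φ : A₀.X ⟶ fiberOver f t₀)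
    (hF : IsCompactAbelianPencil (snd A₀.X 𝒴 ≫ f) (2 * (r + 1)))
    (hB : ∀ η : complexBetti 𝒴 2, StandardConjectureBStar (r + 1 + 1) 𝒴 η) :
    ∃ D ∈ algebraicClasses (A₀.X ⊗ 𝒴) (r + 1),
      fiberGysin hF t₀ (r + 1) (complexBetti.map (fiberι (snd A₀.X 𝒴 ≫ f) t₀) (2 * (r + 1)) D) =
        Γ⟦isSmoothProjective_abelianVariety_of_dim_eq A₀ hA₀, hF, φ, t₀⟧ := by
  obtain ⟨E, hE⟩ := exists_abelianVariety_dim_eq_one ℂ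
  exact exists_algebraic_fibreClassDivisor_graph A₀ hA₀ t₀ φ hF hf fun _ hk ↦
    exists_fibreClassInverse_of_middle_powSucc hf E hE (fun hP ↦ middle_powSucc_of_lefschetzB hf E hE hB hP) hk

end Summit.HodgeConjecture.HodgeConjecture.Theorems

end
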